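import Summits.BirchSwinnertonDyer.Rank1Residual.X4.OldEigenPairOfIhara
import HarnessLib

/-!
# The `ℓ`-old decomposition on cycles FROM the vanishing on the `ℓ`-new cycles: extension across the cokernel of `(α_*, β_*)` by Ihara's lemma (cell `b2b-bsdres`, seat additive-p4, line V46)

HONEST FRAMING (verbatim, cell `b2b-bsdres`): the goal of the cell is to DELETE the COMBINATION-SHAPED
residual classes for ALL analytic-rank `≤ 1` curves over `ℚ` — "full BSD formula for every rank `≤ 1`
curve in class `C`" assembled STRICTLY from published theorems — so that the rank-`≤ 1` remainder
becomes exactly the CONSTRUCTION-SHAPED classes, which are TYPED (missing-input Props), NOT attempted;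
this is not "finishing BSD". This file: TOOL theorems (linear algebra over the period homology of
`X₀(Mℓ)` and `X₀(M)`), 0 defs, 0 facts, nothing booked; X4 CONSTRUCTION-SHAPED.

## What is proved (line V46: the Mazur-principle target shrinks to a vanishing statement at level `Mℓ`)

Fix a prime `ℓ ∤ M`, an odd prime `p`, integer eigenvalues `θ`, and a `𝔽_p`-valued function `Φ` on
`S₂(Γ₀(Mℓ))^∨` which is ADDITIVE on `H₁(X₀(Mℓ), ℤ) = periodHomology (Mℓ)` and `T_r`-EIGEN there
(`Φ(T_r • z) = θ(r) Φ(z)`, primes `r ∤ Mℓ`) — for a rational newform `f` this is the mod-`p` plus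
functional of `X4/PlusFunctionalModP`. Write `α_* = (degeneracyMap0 M (Mℓ) 1 2)^∨`,
`β_* = (degeneracyMap0 M (Mℓ) ℓ 2)^∨` (push-forward of cycles to level `M`).

* (NV) ⟸ (OLD), `apply_eq_zero_of_oldPair` (trivial direction): if `Φ = Λ₁∘α_* + Λ₂∘β_*` on
  `H₁(X₀(Mℓ), ℤ)` with `Λ₁, Λ₂` additive on `H₁(X₀(M), ℤ)`, then `Φ` VANISHES on the `ℓ`-NEW CYCLES
  `ker α_* ∩ ker β_* ∩ H₁(X₀(Mℓ), ℤ)` (the homology of the `ℓ`-new subvariety of `J₀(Mℓ)`).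
* (NV) ⟹ (OLD), **`exists_oldPair_of_apply_eq_zero_of_ribet1984_iharaLemma`** (the theorem of this
  file): if `Φ` vanishes on `ker α_* ∩ ker β_* ∩ H₁(X₀(Mℓ), ℤ)`, then — given Ihara's lemma
  `ribet1984_iharaLemma` BY NAME and ONE numeral prime `q₀ ≡ 1 (mod Mℓ)` with
  `θ(q₀) ≢ q₀ + 1 (mod p)` — there ARE additive `Λ₁, Λ₂ : H₁(X₀(M), ℤ) → 𝔽_p` with
  `Φ = Λ₁∘α_* + Λ₂∘β_*` on `H₁(X₀(Mℓ), ℤ)`. PROOF. (NV) says `Φ` factors through the IMAGE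
  `I = (α_*, β_*)(H₁(X₀(Mℓ), ℤ)) ⊆ H₁(X₀(M), ℤ)²` (`apply_eq_of_dualMap_eq`); the point is to EXTEND
  the induced functional across the (Eisenstein) cokernel. Dichotomy of `X4/LevelLoweringCharacter`
  on `𝔫₀ = (p, T_r − θ(r)) ⊆ 𝕋̃ = ℤ[T_r : r ∤ Mℓ]` (level `M`): if `1 ∈ 𝔫₀` then `Φ = 0` on
  `H₁(X₀(Mℓ), ℤ)` (`apply_eq_zero_of_one_mem_idealSpan_of_dualMap`: every `s ∈ 𝔫₀` transports to
  a level-`Mℓ` operator `t` with `(α_*, β_*)(t • z) = s • (α_*, β_*)(z)` and `Φ(t • ·) = 0`, using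
  the character-free transport `exists_levelRaise_const`; at `s = 1`, `t • z − z` is an `ℓ`-new
  cycle) and `Λ₁ = Λ₂ = 0` do; if `1 ∉ 𝔫₀` then `θ̄` is a character `χ : 𝕋̃ → 𝔽_p`
  (`exists_ringHom_apply_T_eq_of_one_not_mem_idealSpan`) with maximal, odd, non-Eisenstein (`q₀`)
  kernel, Ihara's lemma supplies `s ∉ ker χ` with `s • H₁(X₀(M), ℤ)² ⊆ I` (elementwise: cycles
  `z(x, y)` of level `Mℓ` with `(α_*, β_*)(z(x, y)) = (s • x, s • y)`), and
  `Λ₁(x) := χ(s)⁻¹ Φ(z(x, 0))`, `Λ₂(y) := χ(s)⁻¹ Φ(z(0, y))` are additive (fibre constancy) and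
  satisfy `Λ₁(α_* z) + Λ₂(β_* z) = χ(s)⁻¹ Φ(t • z) = Φ(z)` for the transported `t` of `s`
  (`exists_levelRaise`: `Φ(t • z) = χ(s) Φ(z)`).

So, modulo Ihara BY NAME and the numeral `q₀`, the V45 target "`[·]⁺_f mod p` is `ℓ`-OLD ON CYCLES"
(`MazurPrincipleOldOnCycles`, an `∃` over level-`M` functionals) is EQUIVALENT to the VANISHING of
`[·]⁺_f mod p` on the `ℓ`-new cycles of level `Mℓ` — a statement about `f`'s own symbol at its own
level, with no existential (consumer: `Additive/X4TamDefectMazurPrincipleNewVanishing`).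

## References

* K. A. Ribet, Proc. ICM 1983 (1984), Thm. 4.1 (Ihara's lemma). [cite: Ribet1984ICM, Thm. 4.1]
* H. Darmon, F. Diamond, R. Taylor, *Fermat's Last Theorem* (1995), Lemma 4.28 (a), Lemma 4.30 (b),
  §4.5 p. 137; §4.3 p. 119–120. [cite: DarmonDiamondTaylor1995, Lemma 4.28 (a), Lemma 4.30 (b), §4.5 pp. 135–137]
* F. Diamond, J. Shurman, *A first course in modular forms* (2005), Prop. 5.6.2. [cite: DiamondShurman2005, Prop. 5.6.2]
* K. Ribet, W. Stein, *Lectures on Serre's conjectures* (2001), Thm. 3.14 (Mazur's principle — the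
  provenance of (NV), not used). [cite: RibetStein2001, Thm. 3.14 and Lemma 3.17]
-/

noncomputable section

open scoped MatrixGroups ModularForm

open CongruenceSubgroup Finset Matrix

open Literature.NumberTheory.EllipticCurves Literature.NumberTheory.EllipticCurves.ModularForms
  Literature.NumberTheory.EllipticCurves.ModularForms.HidaCohomology

namespace Summit.BirchSwinnertonDyer.Rank1Residual.LevelLowering

/-! ### §1 Character-free transport of `𝕋̃` to level `Mℓ` (with an eigen-constant) -/

section Transport

variable {k : Type*} [CommRing k] {M : ℕ} [NeZero M] {ℓ : ℕ} [Fact ℓ.Prime]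

/-- **Transport of `𝕋̃` to level `Mℓ`, character-free.** For every `s ∈ 𝕋̃ = ℤ[T_r : r ∤ Mℓ]`
(operators of level `M`) there is `t ∈ 𝕋_ℤ(Mℓ)` with `α_*(t • z) = s • α_* z`,
`β_*(t • z) = s • β_* z` (all `z`), and a constant `c ∈ k` with `Φ(t • z) = c Φ(z)` on
`H₁(X₀(Mℓ), ℤ)`, for every `Φ` additive there with `Φ(T_r • z) = θ(r) Φ(z)` (`r ∤ Mℓ`): generators
`T_r ↦ T_r`, `c = θ(r)` (Diamond–Shurman Prop. 5.6.2, the tree's `heckeT_degeneracyMap0`), then sums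
and products. No ring homomorphism `𝕋̃ → k` is needed (cf. `exists_levelRaise`).
[cite: DiamondShurman2005, Prop. 5.6.2] -/
theorem exists_levelRaise_const (θ : ℕ → ℤ) (Φ : Module.Dual ℂ (CuspForm (Gamma0 (M * ℓ)) 2) → k)
    (haddΦ : ∀ x ∈ periodHomology (M * ℓ), ∀ y ∈ periodHomology (M * ℓ), Φ (x + y) = Φ x + Φ y)
    (hΦT : ∀ (r : ℕ) (hr : r.Prime), ¬ r ∣ M * ℓ → ∀ z ∈ periodHomology (M * ℓ),
      Φ (HeckeRing0.T (M * ℓ) 2 r hr • z) = (θ r : k) * Φ z)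
    (s : HeckeRing0 M 2) (hs : s ∈ HeckeRing0.primeTo M 2 (M * ℓ)) :
    ∃ t : HeckeRing0 (M * ℓ) 2,
      (∀ z, (degeneracyMap0 M (M * ℓ) 1 2).dualMap (t • z) =
        s • (degeneracyMap0 M (M * ℓ) 1 2).dualMap z) ∧
      (∀ z, (degeneracyMap0 M (M * ℓ) ℓ 2).dualMap (t • z) =
        s • (degeneracyMap0 M (M * ℓ) ℓ 2).dualMap z) ∧
      ∃ c : k, ∀ z ∈ periodHomology (M * ℓ), Φ (t • z) = c * Φ z := by
  have h1 : M * 1 ∣ M * ℓ := by rw [mul_one]; exact dvd_mul_right M ℓ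
  have hℓ' : M * ℓ ∣ M * ℓ := dvd_rfl
  change s ∈ Algebra.adjoin ℤ _ at hs
  induction hs using Algebra.adjoin_induction with
  | mem x hx =>
    obtain ⟨r, hr, hrN, rfl⟩ := hx
    exact ⟨HeckeRing0.T (M * ℓ) 2 r hr, fun z ↦ dualMap_degeneracyMap0_T_smul h1 hr hrN z,
      fun z ↦ dualMap_degeneracyMap0_T_smul hℓ' hr hrN z, (θ r : k), fun z hz ↦ hΦT r hr hrN z hz⟩
  | algebraMap n =>
    refine ⟨algebraMap ℤ _ n, fun z ↦ ?_, fun z ↦ ?_, (n : k), fun z hz ↦ ?_⟩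
    · rw [Algebra.algebraMap_eq_smul_one, Algebra.algebraMap_eq_smul_one, smul_assoc, one_smul,
        map_zsmul, smul_assoc, one_smul]
    · rw [Algebra.algebraMap_eq_smul_one, Algebra.algebraMap_eq_smul_one, smul_assoc, one_smul,
        map_zsmul, smul_assoc, one_smul]
    · rw [eq_intCast, apply_intCast_smul_of_additive Φ haddΦ hz]
  | add x y _ _ hx hy =>
    obtain ⟨t₁, ha₁, hb₁, c₁, hΦ₁⟩ := hx
    obtain ⟨t₂, ha₂, hb₂, c₂, hΦ₂⟩ := hy
    refine ⟨t₁ + t₂, fun z ↦ ?_, fun z ↦ ?_, c₁ + c₂, fun z hz ↦ ?_⟩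
    · rw [add_smul, map_add, ha₁, ha₂, add_smul]
    · rw [add_smul, map_add, hb₁, hb₂, add_smul]
    · rw [add_smul, haddΦ _ (HeckeRing0.smul_mem_periodHomology _ t₁ hz) _
        (HeckeRing0.smul_mem_periodHomology _ t₂ hz), hΦ₁ z hz, hΦ₂ z hz]
      ring
  | mul x y _ _ hx hy =>
    obtain ⟨t₁, ha₁, hb₁, c₁, hΦ₁⟩ := hx
    obtain ⟨t₂, ha₂, hb₂, c₂, hΦ₂⟩ := hy
    refine ⟨t₁ * t₂, fun z ↦ ?_, fun z ↦ ?_, c₁ * c₂, fun z hz ↦ ?_⟩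
    · rw [mul_smul, ha₁, ha₂, smul_smul]
    · rw [mul_smul, hb₁, hb₂, smul_smul]
    · rw [mul_smul, hΦ₁ _ (HeckeRing0.smul_mem_periodHomology _ t₂ hz), hΦ₂ z hz]
      ring

end Transport

/-! ### §2 Fibre constancy and the branch `1 ∈ 𝔫₀` under the vanishing on the `ℓ`-new cycles -/

section NewVanishing

variable {k : Type*} [CommRing k] {M : ℕ} [NeZero M] {ℓ : ℕ} [Fact ℓ.Prime] {p : ℕ}

/-- **Fibre constancy.** If `Φ` is additive on `H₁(X₀(Mℓ), ℤ)` and vanishes on the `ℓ`-new cycles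
(`α_* z = 0`, `β_* z = 0`), then `Φ` is constant on the fibres of `(α_*, β_*)` in `H₁(X₀(Mℓ), ℤ)`:
`Φ` factors through the image `(α_*, β_*)(H₁(X₀(Mℓ), ℤ)) ⊆ H₁(X₀(M), ℤ)²`. [folklore] -/
theorem apply_eq_of_dualMap_eq (Φ : Module.Dual ℂ (CuspForm (Gamma0 (M * ℓ)) 2) → k)
    (haddΦ : ∀ x ∈ periodHomology (M * ℓ), ∀ y ∈ periodHomology (M * ℓ), Φ (x + y) = Φ x + Φ y)
    (hvan : ∀ z ∈ periodHomology (M * ℓ), (degeneracyMap0 M (M * ℓ) 1 2).dualMap z = 0 →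
      (degeneracyMap0 M (M * ℓ) ℓ 2).dualMap z = 0 → Φ z = 0)
    {z z' : Module.Dual ℂ (CuspForm (Gamma0 (M * ℓ)) 2)} (hz : z ∈ periodHomology (M * ℓ))
    (hz' : z' ∈ periodHomology (M * ℓ))
    (hα : (degeneracyMap0 M (M * ℓ) 1 2).dualMap z = (degeneracyMap0 M (M * ℓ) 1 2).dualMap z')
    (hβ : (degeneracyMap0 M (M * ℓ) ℓ 2).dualMap z = (degeneracyMap0 M (M * ℓ) ℓ 2).dualMap z') :
    Φ z = Φ z' := by
  have h := hvan (z - z') (sub_mem hz hz') (by rw [map_sub, hα, sub_self])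
    (by rw [map_sub, hβ, sub_self])
  rw [apply_sub_of_additive Φ haddΦ hz hz'] at h
  exact sub_eq_zero.mp h

/-- **If `1 ∈ 𝔫₀ = (p, T_r − θ(r) : r ∤ Mℓ prime) ⊆ 𝕋̃` then a `θ̄`-eigen-functional vanishing on the
`ℓ`-new cycles vanishes on ALL of `H₁(X₀(Mℓ), ℤ)`** (`Φ` `k`-valued with `(p : k) = 0`, additive and
`T_r`-eigen on the lattice). Proof: by induction over the ideal, every `s ∈ 𝔫₀` (an operator of
level `M`) transports to some `t ∈ 𝕋_ℤ(Mℓ)` with `α_*(t • z) = s • α_* z`, `β_*(t • z) = s • β_* z`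
and `Φ(t • ·) = 0` on the lattice — generators `p ↦ p` (`Φ(p • z) = p Φ(z) = 0`) and
`T_r − θ(r) ↦ T_r − θ(r)` (`Φ(T_r • z) − θ(r) Φ(z) = 0`), sums, and multiples `a s ↦ t_a t_s` with
`t_a` the character-free transport of `a ∈ 𝕋̃` (`exists_levelRaise_const`: `Φ(t_a • w) = c Φ(w)`);
at `s = 1` the cycle `t • z − z` is `ℓ`-new, so `Φ(z) = Φ(t • z) = 0`.
[cite: DarmonDiamondTaylor1995, §4.3 (p. 119) and Lemma 4.30] [cite: DiamondShurman2005, Prop. 5.6.2] -/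
theorem apply_eq_zero_of_one_mem_idealSpan_of_dualMap (θ : ℕ → ℤ) (hp : (p : k) = 0)
    (Φ : Module.Dual ℂ (CuspForm (Gamma0 (M * ℓ)) 2) → k)
    (haddΦ : ∀ x ∈ periodHomology (M * ℓ), ∀ y ∈ periodHomology (M * ℓ), Φ (x + y) = Φ x + Φ y)
    (hΦT : ∀ (r : ℕ) (hr : r.Prime), ¬ r ∣ M * ℓ → ∀ z ∈ periodHomology (M * ℓ),
      Φ (HeckeRing0.T (M * ℓ) 2 r hr • z) = (θ r : k) * Φ z)
    (hvan : ∀ z ∈ periodHomology (M * ℓ), (degeneracyMap0 M (M * ℓ) 1 2).dualMap z = 0 →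
      (degeneracyMap0 M (M * ℓ) ℓ 2).dualMap z = 0 → Φ z = 0)
    (h1 : (1 : HeckeRing0.primeTo M 2 (M * ℓ)) ∈ Ideal.span
      ({(p : HeckeRing0.primeTo M 2 (M * ℓ))} ∪
        {x | ∃ (r : ℕ) (hr : r.Prime) (hrS : ¬ r ∣ M * ℓ),
          x = HeckeRing0.primeTo.T M 2 (M * ℓ) hr hrS - (θ r : HeckeRing0.primeTo M 2 (M * ℓ))})) :
    ∀ z ∈ periodHomology (M * ℓ), Φ z = 0 := by
  have hℓ : ℓ.Prime := Fact.out
  haveI : NeZero ℓ := ⟨hℓ.ne_zero⟩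
  have h1d : M * 1 ∣ M * ℓ := by rw [mul_one]; exact dvd_mul_right M ℓ
  have hℓd : M * ℓ ∣ M * ℓ := dvd_rfl
  have hΦ0 : Φ 0 = 0 := apply_zero_of_additive Φ haddΦ
  -- the transport statement, by induction over the ideal
  suffices key : ∀ s ∈ Ideal.span
      ({(p : HeckeRing0.primeTo M 2 (M * ℓ))} ∪
        {x | ∃ (r : ℕ) (hr : r.Prime) (hrS : ¬ r ∣ M * ℓ),
          x = HeckeRing0.primeTo.T M 2 (M * ℓ) hr hrS - (θ r : HeckeRing0.primeTo M 2 (M * ℓ))}),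
      ∃ t : HeckeRing0 (M * ℓ) 2,
        (∀ z, (degeneracyMap0 M (M * ℓ) 1 2).dualMap (t • z) =
          (s : HeckeRing0 M 2) • (degeneracyMap0 M (M * ℓ) 1 2).dualMap z) ∧
        (∀ z, (degeneracyMap0 M (M * ℓ) ℓ 2).dualMap (t • z) =
          (s : HeckeRing0 M 2) • (degeneracyMap0 M (M * ℓ) ℓ 2).dualMap z) ∧
        ∀ z ∈ periodHomology (M * ℓ), Φ (t • z) = 0 by
    intro z hz
    obtain ⟨t, hα, hβ, ht⟩ := key 1 h1
    have htz : t • z ∈ periodHomology (M * ℓ) := HeckeRing0.smul_mem_periodHomology _ t hz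
    rw [apply_eq_of_dualMap_eq Φ haddΦ hvan hz htz (by rw [hα z, OneMemClass.coe_one, one_smul])
      (by rw [hβ z, OneMemClass.coe_one, one_smul])]
    exact ht z hz
  intro s hs
  induction hs using Submodule.span_induction with
  | mem x hx =>
    rcases hx with hx | ⟨r, hr, hrS, rfl⟩
    · -- `x = p ↦ t = p`: `Φ(p • z) = p Φ(z) = 0`
      rw [Set.mem_singleton_iff] at hx
      subst hx
      have ep : ((p : HeckeRing0.primeTo M 2 (M * ℓ)) : HeckeRing0 M 2) = ((p : ℤ) : HeckeRing0 M 2) := by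
        rw [SubringClass.coe_natCast, Int.cast_natCast]
      refine ⟨((p : ℤ) : HeckeRing0 (M * ℓ) 2), fun z ↦ ?_, fun z ↦ ?_, fun z hz ↦ ?_⟩
      · rw [ep, Int.cast_smul_eq_zsmul, Int.cast_smul_eq_zsmul, map_zsmul]
      · rw [ep, Int.cast_smul_eq_zsmul, Int.cast_smul_eq_zsmul, map_zsmul]
      · rw [apply_intCast_smul_of_additive Φ haddΦ hz, Int.cast_natCast, hp, zero_mul]
    · -- `x = T_r − θ(r) ↦ t = T_r − θ(r)`: `Φ(T_r • z) − θ(r) Φ(z) = 0`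
      have eT : ((HeckeRing0.primeTo.T M 2 (M * ℓ) hr hrS -
          (θ r : HeckeRing0.primeTo M 2 (M * ℓ)) : HeckeRing0.primeTo M 2 (M * ℓ)) : HeckeRing0 M 2) =
          HeckeRing0.T M 2 r hr - ((θ r : ℤ) : HeckeRing0 M 2) := by
        rw [AddSubgroupClass.coe_sub, HeckeRing0.primeTo.coe_T, SubringClass.coe_intCast]
      refine ⟨HeckeRing0.T (M * ℓ) 2 r hr - ((θ r : ℤ) : HeckeRing0 (M * ℓ) 2), fun z ↦ ?_,
        fun z ↦ ?_, fun z hz ↦ ?_⟩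
      · rw [eT, sub_smul, sub_smul, map_sub, dualMap_degeneracyMap0_T_smul h1d hr hrS z,
          Int.cast_smul_eq_zsmul, Int.cast_smul_eq_zsmul, map_zsmul]
      · rw [eT, sub_smul, sub_smul, map_sub, dualMap_degeneracyMap0_T_smul hℓd hr hrS z,
          Int.cast_smul_eq_zsmul, Int.cast_smul_eq_zsmul, map_zsmul]
      · rw [sub_smul, apply_sub_of_additive Φ haddΦ (HeckeRing0.smul_mem_periodHomology _ _ hz)
            (HeckeRing0.smul_mem_periodHomology _ _ hz), hΦT r hr hrS z hz,
          apply_intCast_smul_of_additive Φ haddΦ hz, sub_self]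
  | zero =>
    refine ⟨0, fun z ↦ ?_, fun z ↦ ?_, fun z _ ↦ ?_⟩
    · rw [zero_smul, map_zero, ZeroMemClass.coe_zero, zero_smul]
    · rw [zero_smul, map_zero, ZeroMemClass.coe_zero, zero_smul]
    · rw [zero_smul, hΦ0]
  | add x y _ _ hx hy =>
    obtain ⟨t₁, ha₁, hb₁, hΦ₁⟩ := hx
    obtain ⟨t₂, ha₂, hb₂, hΦ₂⟩ := hy
    refine ⟨t₁ + t₂, fun z ↦ ?_, fun z ↦ ?_, fun z hz ↦ ?_⟩
    · rw [add_smul, map_add, ha₁, ha₂, AddMemClass.coe_add, add_smul]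
    · rw [add_smul, map_add, hb₁, hb₂, AddMemClass.coe_add, add_smul]
    · rw [add_smul, haddΦ _ (HeckeRing0.smul_mem_periodHomology _ t₁ hz) _
        (HeckeRing0.smul_mem_periodHomology _ t₂ hz), hΦ₁ z hz, hΦ₂ z hz, add_zero]
  | smul a x _ hx =>
    obtain ⟨tₓ, haₓ, hbₓ, hΦₓ⟩ := hx
    -- transport `a ∈ 𝕋̃` character-free
    obtain ⟨tₐ, haₐ, hbₐ, c, hΦₐ⟩ := exists_levelRaise_const θ Φ haddΦ hΦT (a : HeckeRing0 M 2) a.2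
    refine ⟨tₐ * tₓ, fun z ↦ ?_, fun z ↦ ?_, fun z hz ↦ ?_⟩
    · rw [mul_smul, haₐ, haₓ, smul_smul, smul_eq_mul, MulMemClass.coe_mul]
    · rw [mul_smul, hbₐ, hbₓ, smul_smul, smul_eq_mul, MulMemClass.coe_mul]
    · rw [mul_smul, hΦₐ _ (HeckeRing0.smul_mem_periodHomology _ tₓ hz), hΦₓ z hz, mul_zero]

/-- **(NV) ⟸ (OLD), the trivial direction.** An `ℓ`-old functional `Φ = Λ₁∘α_* + Λ₂∘β_*` on
`H₁(X₀(Mℓ), ℤ)` (`Λ₁, Λ₂` additive on `H₁(X₀(M), ℤ)`, so `Λᵢ(0) = 0`) vanishes on the `ℓ`-new cycles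
`ker α_* ∩ ker β_*`. [folklore] -/
theorem apply_eq_zero_of_oldPair (Φ : Module.Dual ℂ (CuspForm (Gamma0 (M * ℓ)) 2) → k)
    (Λ₁ Λ₂ : Module.Dual ℂ (CuspForm (Gamma0 M) 2) → k)
    (hadd₁ : ∀ x ∈ periodHomology M, ∀ y ∈ periodHomology M, Λ₁ (x + y) = Λ₁ x + Λ₁ y)
    (hadd₂ : ∀ x ∈ periodHomology M, ∀ y ∈ periodHomology M, Λ₂ (x + y) = Λ₂ x + Λ₂ y)
    (hold : ∀ z ∈ periodHomology (M * ℓ),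
      Φ z = Λ₁ ((degeneracyMap0 M (M * ℓ) 1 2).dualMap z) +
        Λ₂ ((degeneracyMap0 M (M * ℓ) ℓ 2).dualMap z)) :
    ∀ z ∈ periodHomology (M * ℓ), (degeneracyMap0 M (M * ℓ) 1 2).dualMap z = 0 →
      (degeneracyMap0 M (M * ℓ) ℓ 2).dualMap z = 0 → Φ z = 0 := by
  intro z hz hα hβ
  rw [hold z hz, hα, hβ, apply_zero_of_additive Λ₁ hadd₁, apply_zero_of_additive Λ₂ hadd₂, add_zero]

end NewVanishing

/-! ### §3 (NV) ⟹ (OLD): extension across the cokernel of `(α_*, β_*)` by Ihara's lemma -/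

section Extension

variable {M : ℕ} [NeZero M] {ℓ : ℕ} [Fact ℓ.Prime] {p : ℕ} [hp : Fact p.Prime]

/-- **THE `ℓ`-OLD DECOMPOSITION ON CYCLES FROM THE VANISHING ON THE `ℓ`-NEW CYCLES — Ihara BY NAME,
no multiplicity one.** Let `ℓ ∤ M`, `p` odd, `θ` integer eigenvalues, `Φ : S₂(Γ₀(Mℓ))^∨ → 𝔽_p`
additive and `T_r`-eigen (`r ∤ Mℓ`) on `H₁(X₀(Mℓ), ℤ)`, VANISHING on `ker α_* ∩ ker β_* ∩ H₁(X₀(Mℓ), ℤ)`;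
let `q₀ ≡ 1 (mod Mℓ)` be a prime with `θ(q₀) ≢ q₀ + 1 (mod p)`. Then there are `Λ₁, Λ₂` additive on
`H₁(X₀(M), ℤ)` with `Φ(z) = Λ₁(α_* z) + Λ₂(β_* z)` for every `z ∈ H₁(X₀(Mℓ), ℤ)`. (Dichotomy on
`𝔫₀ = (p, T_r − θ(r))`: `1 ∈ 𝔫₀` kills `Φ`; else `θ̄ = χ` is a character of `𝕋̃` with odd,
non-Eisenstein maximal kernel, Ihara's `s ∉ ker χ` multiplies `H₁(X₀(M), ℤ)²` into the image of
`(α_*, β_*)`, and `Λ(x, y) = χ(s)⁻¹ Φ(z(s • x, s • y))` is the extension — see the module docstring.)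
[cite: Ribet1984ICM, Thm. 4.1] [cite: DarmonDiamondTaylor1995, Lemma 4.28 (a), Lemma 4.30 (b), §4.5 pp. 135–137] -/
theorem exists_oldPair_of_apply_eq_zero_of_ribet1984_iharaLemma (hI : ribet1984_iharaLemma)
    (hℓM : ¬ ℓ ∣ M) (hp2 : p ≠ 2) (θ : ℕ → ℤ)
    (Φ : Module.Dual ℂ (CuspForm (Gamma0 (M * ℓ)) 2) → ZMod p)
    (haddΦ : ∀ x ∈ periodHomology (M * ℓ), ∀ y ∈ periodHomology (M * ℓ), Φ (x + y) = Φ x + Φ y)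
    (hΦT : ∀ (r : ℕ) (hr : r.Prime), ¬ r ∣ M * ℓ → ∀ z ∈ periodHomology (M * ℓ),
      Φ (HeckeRing0.T (M * ℓ) 2 r hr • z) = ((θ r : ℤ) : ZMod p) * Φ z)
    (hvan : ∀ z ∈ periodHomology (M * ℓ), (degeneracyMap0 M (M * ℓ) 1 2).dualMap z = 0 →
      (degeneracyMap0 M (M * ℓ) ℓ 2).dualMap z = 0 → Φ z = 0)
    {q₀ : ℕ} (hq₀ : q₀.Prime) (hq₀1 : q₀ ≡ 1 [MOD M * ℓ])
    (hθq₀ : ((θ q₀ : ℤ) : ZMod p) ≠ q₀ + 1) :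
    ∃ Λ₁ Λ₂ : Module.Dual ℂ (CuspForm (Gamma0 M) 2) → ZMod p,
      (∀ x ∈ periodHomology M, ∀ y ∈ periodHomology M, Λ₁ (x + y) = Λ₁ x + Λ₁ y) ∧
      (∀ x ∈ periodHomology M, ∀ y ∈ periodHomology M, Λ₂ (x + y) = Λ₂ x + Λ₂ y) ∧
      ∀ z ∈ periodHomology (M * ℓ),
        Φ z = Λ₁ ((degeneracyMap0 M (M * ℓ) 1 2).dualMap z) +
          Λ₂ ((degeneracyMap0 M (M * ℓ) ℓ 2).dualMap z) := by
  classical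
  have hℓ : ℓ.Prime := Fact.out
  haveI : NeZero ℓ := ⟨hℓ.ne_zero⟩
  have h1d : M * 1 ∣ M * ℓ := by rw [mul_one]; exact dvd_mul_right M ℓ
  have hℓd : M * ℓ ∣ M * ℓ := dvd_rfl
  have hq₀N : ¬ q₀ ∣ M * ℓ := by
    intro hd
    have h01 : 1 ≡ 0 [MOD q₀] :=
      ((hq₀1.of_dvd hd).symm.trans (Nat.modEq_zero_iff_dvd.mpr (dvd_refl q₀)))
    exact hq₀.one_lt.ne' (Nat.dvd_one.mp (Nat.modEq_zero_iff_dvd.mp h01))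
  by_cases h1 : (1 : HeckeRing0.primeTo M 2 (M * ℓ)) ∈ Ideal.span
      ({(p : HeckeRing0.primeTo M 2 (M * ℓ))} ∪
        {x | ∃ (r : ℕ) (hr : r.Prime) (hrS : ¬ r ∣ M * ℓ),
          x = HeckeRing0.primeTo.T M 2 (M * ℓ) hr hrS - (θ r : HeckeRing0.primeTo M 2 (M * ℓ))})
  · -- CASE 1: `1 ∈ 𝔫₀` ⟹ `Φ = 0` on cycles; `Λ₁ = Λ₂ = 0`
    have hzero := apply_eq_zero_of_one_mem_idealSpan_of_dualMap θ (ZMod.natCast_self p) Φ haddΦ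
      hΦT hvan h1
    refine ⟨fun _ ↦ 0, fun _ ↦ 0, fun _ _ _ _ ↦ (add_zero _).symm, fun _ _ _ _ ↦ (add_zero _).symm,
      fun z hz ↦ ?_⟩
    rw [hzero z hz, add_zero]
  · -- CASE 2: `θ̄` is a character `χ` of the level-`M` Hecke ring
    obtain ⟨χ, hχ⟩ := exists_ringHom_apply_T_eq_of_one_not_mem_idealSpan (p := p) θ h1
    have h𝔫 : (RingHom.ker χ).IsMaximal :=
      RingHom.ker_isMaximal_of_surjective χ (ZMod.ringHom_surjective χ)
    have h2 : (2 : ZMod p) ≠ 0 := by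
      rw [show (2 : ZMod p) = ((2 : ℕ) : ZMod p) by norm_cast, Ne, ZMod.natCast_eq_zero_iff]
      exact fun h ↦ hp2 ((Nat.prime_dvd_prime_iff_eq hp.out Nat.prime_two).mp h)
    have h2' : (2 : HeckeRing0.primeTo M 2 (M * ℓ)) ∉ RingHom.ker χ := by
      rw [RingHom.mem_ker, map_ofNat]; exact h2
    have hE : ¬ HeckeRing0.primeTo.IsEisenstein (RingHom.ker χ) := by
      intro hEis
      have h := hEis q₀ hq₀ hq₀N hq₀1
      rw [RingHom.mem_ker, map_sub, hχ q₀ hq₀ hq₀N, map_add, map_natCast, map_one, sub_eq_zero] at h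
      exact hθq₀ h
    have hΦTχ : ∀ (r : ℕ) (hr : r.Prime) (hrS : ¬ r ∣ M * ℓ), ∀ z ∈ periodHomology (M * ℓ),
        Φ (HeckeRing0.T (M * ℓ) 2 r hr • z) = χ (HeckeRing0.primeTo.T M 2 (M * ℓ) hr hrS) * Φ z :=
      fun r hr hrS z hz ↦ by rw [hχ r hr hrS]; exact hΦT r hr hrS z hz
    -- Ihara's element `s ∉ ker χ` and its transport `t` to level `Mℓ`
    obtain ⟨s, hs, hsur⟩ := hI M ℓ hℓM (RingHom.ker χ) h𝔫 h2' hE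
    have hcs : χ s ≠ 0 := fun h ↦ hs (by rwa [RingHom.mem_ker])
    obtain ⟨t, hαt, hβt, hΦt⟩ := exists_levelRaise Φ χ haddΦ hΦTχ (s : HeckeRing0 M 2) s.2
    -- the cycles `z(x, y)` of level `Mℓ` over `(s • x, s • y)`
    choose! zf hzf hzfα hzfβ using hsur
    have h0M : (0 : Module.Dual ℂ (CuspForm (Gamma0 M) 2)) ∈ periodHomology M := zero_mem _
    -- the extension
    refine ⟨fun x ↦ (χ s)⁻¹ * Φ (zf x 0), fun y ↦ (χ s)⁻¹ * Φ (zf 0 y), fun x hx y hy ↦ ?_,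
      fun x hx y hy ↦ ?_, fun z hz ↦ ?_⟩
    · -- `Λ₁` is additive: fibre constancy over `(s • (x + y), 0)`
      beta_reduce
      have hsum : zf x 0 + zf y 0 ∈ periodHomology (M * ℓ) := add_mem (hzf x hx 0 h0M) (hzf y hy 0 h0M)
      rw [← mul_add, ← haddΦ _ (hzf x hx 0 h0M) _ (hzf y hy 0 h0M),
        apply_eq_of_dualMap_eq Φ haddΦ hvan (hzf _ (add_mem hx hy) 0 h0M) hsum
          (by rw [map_add, hzfα _ (add_mem hx hy) 0 h0M, hzfα x hx 0 h0M, hzfα y hy 0 h0M, smul_add])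
          (by rw [map_add, hzfβ _ (add_mem hx hy) 0 h0M, hzfβ x hx 0 h0M, hzfβ y hy 0 h0M,
            smul_zero, add_zero])]
    · -- `Λ₂` is additive: fibre constancy over `(0, s • (x + y))`
      beta_reduce
      have hsum : zf 0 x + zf 0 y ∈ periodHomology (M * ℓ) := add_mem (hzf 0 h0M x hx) (hzf 0 h0M y hy)
      rw [← mul_add, ← haddΦ _ (hzf 0 h0M x hx) _ (hzf 0 h0M y hy),
        apply_eq_of_dualMap_eq Φ haddΦ hvan (hzf 0 h0M _ (add_mem hx hy)) hsum
          (by rw [map_add, hzfα 0 h0M _ (add_mem hx hy), hzfα 0 h0M x hx, hzfα 0 h0M y hy,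
            smul_zero, add_zero])
          (by rw [map_add, hzfβ 0 h0M _ (add_mem hx hy), hzfβ 0 h0M x hx, hzfβ 0 h0M y hy, smul_add])]
    · -- the identity on cycles: `Λ₁(α_* z) + Λ₂(β_* z) = χ(s)⁻¹ Φ(t • z) = Φ(z)`
      beta_reduce
      set x := (degeneracyMap0 M (M * ℓ) 1 2).dualMap z with hx
      set y := (degeneracyMap0 M (M * ℓ) ℓ 2).dualMap z with hy
      have hxM : x ∈ periodHomology M := dualMap_degeneracyMap0_mem_periodHomology M (M * ℓ) 1 h1d hz
      have hyM : y ∈ periodHomology M := dualMap_degeneracyMap0_mem_periodHomology M (M * ℓ) ℓ hℓd hz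
      have hsum : zf x 0 + zf 0 y ∈ periodHomology (M * ℓ) := add_mem (hzf x hxM 0 h0M) (hzf 0 h0M y hyM)
      have htz : t • z ∈ periodHomology (M * ℓ) := HeckeRing0.smul_mem_periodHomology _ t hz
      have hw : Φ (zf x 0 + zf 0 y) = Φ (t • z) :=
        apply_eq_of_dualMap_eq Φ haddΦ hvan hsum htz
          (by rw [map_add, hzfα x hxM 0 h0M, hzfα 0 h0M y hyM, smul_zero, add_zero, hαt z])
          (by rw [map_add, hzfβ x hxM 0 h0M, hzfβ 0 h0M y hyM, smul_zero, zero_add, hβt z])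
      rw [← mul_add, ← haddΦ _ (hzf x hxM 0 h0M) _ (hzf 0 h0M y hyM), hw, hΦt z hz, ← mul_assoc,
        Subtype.coe_eta, inv_mul_cancel₀ hcs, one_mul]

end Extension

end Summit.BirchSwinnertonDyer.Rank1Residual.LevelLowering

end
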